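import Summits.KontsevichZagierPeriods.KontsevichZagierPeriods.Theorems.AbelContractionRealHyperellipticSectorBudgetKit
import Summits.KontsevichZagierPeriods.KontsevichZagierPeriods.Theorems.AbelContractionRealHyperellipticSectorEnginePencilKit
import Summits.KontsevichZagierPeriods.KontsevichZagierPeriods.Theorems.AbelContractionRealHyperellipticSectorEnginePencilRoots
import Summits.KontsevichZagierPeriods.KontsevichZagierPeriods.Theorems.AbelContractionRealHyperellipticSectorEngineSignedSum
import Summits.KontsevichZagierPeriods.KontsevichZagierPeriods.Theorems.AbelContractionRealHyperellipticSectorArcExactSubConst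
import Summits.KontsevichZagierPeriods.KontsevichZagierPeriods.Theorems.HermiteRigidityGenusTwoCycleTransferPushforwardDimOne
import Summits.KontsevichZagierPeriods.KontsevichZagierPeriods.Theorems.HermiteRigidityGenusTwoCycleTransferSemialgebraicInvFunOn
import Literature.NumberTheory.Transcendental.SemialgebraicDerivativeProofs
import Literature.NumberTheory.Transcendental.SemialgebraicLineDeriv

/-!
# Route AbelContraction — `RealHyperellipticSector` (crux stmt-KontsevichZagierPeriods-12475): `stub_engine`

Closing file of the registered stub `stub_engine` of the line `Lines/birth.lean` (lead seat c2,
`--supports` the crux): **the contraction engine in all genera** — for every `q ∈ ℚ[X]` the real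
Cauchy relators `Σ_{j ≤ g} (−1)^j [O_j, P/√q]` of `cauchyRel q` (M-polynomial `q` of degree
`2g + 2` with negative leading coefficient and real simple roots `e 0 < ⋯ < e (2g+1)`, ovals
`O_j = (e (2j), e (2j+1))`, `deg P < g`) lie in the truncated relations `KZ.relationsLE 1`.

THE CHAIN (separating pencil = trace of the first-kind form `P dx/y` under a `g¹_{g+1}`), entirely
among representations of dimension `1`:
* write `q = lc·N·D`, `N = ∏_k (x − e(2k))`, `D = ∏_k (x − e(2k+1))`, `λ = −lc > 0`
  (`engine_mPoly_factor`, `engine_prod_range_even_odd`); the rational map `ψ = q/D² = −λN/D` is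
  `ℚ`-semialgebraic on each oval, injective there, with image `(0, ∞)`: its fibre over `u > 0` is
  the zero set of the pencil `c_u = λN + uD`, one simple root `x_j(u)` per oval
  (`engine_pencil_roots`, `Engine.eq_root_of_prod_eq_zero`);
* ONE rule-(2) move per oval (`HermiteRigidity.GenusTwoCycleTransfer.stub_pushforwardDimOne`, with
  the semialgebraic inverse `stub_semialgebraicInvFunOn` and the semialgebraic derivative
  `IsSemialgebraicFunOn.hasDerivAt_isSemialgebraic_holds`): `[O_j, P/√q] − [(0,∞), h_j] ∈ movesLE 1`
  with `h_j(u) = P(x_j)/(√q(x_j)|ψ'(x_j)|) = (−1)^{g−j} P(x_j)/(√u (λ+u) ∏_{m≠j}(x_j − x_m))`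
  (`Engine.psi'_eq_of_pencil`, `Engine.pushforward_value`, `engine_root_gap_sign`);
* `Σ_j (−1)^j h_j ≡ 0` on `(0, ∞)` by the Lagrange identity (`Engine.signed_sum_pushforward_eq_zero`,
  `deg P ≤ g − 1 = deg c_u − 2`), so `Σ_j (−1)^j [(0,∞), h_j] ∈ relationsLE 1` by iterated rule (1b)
  (`engine_signed_sum_mem_relationsLE`).
No Newton–Leibniz move, no representation of dimension `≥ 2`, no winding numbers: the value
identity `Σ_j (−1)^j ∫_{O_j} P/√q = 0` (classically the real part of Cauchy's theorem for
`P dz/√q` in the upper half plane) becomes a COROLLARY of soundness.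

References: M. Kontsevich, D. Zagier, *Periods* (2001), §1.2 rules (1)–(2) [KontsevichZagier2001];
B. Gross, J. Harris, *Real algebraic curves*, Ann. Sci. ÉNS 14 (1981), §3 [GrossHarris1981];
J. Bochnak, M. Coste, M.-F. Roy, *Real Algebraic Geometry* (1998), §2.2 [BochnakCosteRoy1998].
No definitions are introduced.
-/

noncomputable section

open Set MeasureTheory Finset
open scoped Polynomial
open Literature.ModelTheory.ExponentialFields (IsSemialgebraic)
open Literature.NumberTheory.Transcendental Literature.NumberTheory.Transcendental.KZ
open Summit.KontsevichZagierPeriods.HermiteRigidity.GenusTwoCycleTransfer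
  (stub_pushforwardDimOne stub_semialgebraicInvFunOn)

namespace Summit.KontsevichZagierPeriods.AbelContraction.RealHyperellipticSector

namespace Engine

/-- `ψ = q/D²` is `ℚ`-semialgebraic on any `ℚ`-semialgebraic subset of the line where `D ≠ 0`
(`q ∈ ℚ[X]`, the odd-indexed branch points `e (2k+1)` real algebraic). [cite: BochnakCosteRoy1998, §2.2] -/
theorem psi_semialgebraic (q : ℚ[X]) (g : ℕ) (e : ℕ → ℝ)
    (halg : ∀ k, k < g + 1 → IsAlgebraic ℚ (e (2 * k + 1))) {σ : Set (Fin 1 → ℝ)}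
    (hσ : IsSemialgebraic ℚ σ) (hD : ∀ p ∈ σ, ∏ k ∈ range (g + 1), (p 0 - e (2 * k + 1)) ≠ 0) :
    IsSemialgebraicFunOn ℚ σ
      (fun p => (Polynomial.aeval (p 0) q : ℝ) / (∏ k ∈ range (g + 1), (p 0 - e (2 * k + 1))) ^ 2) := by
  have hx0 : IsSemialgebraicFunOn ℚ σ (fun p : Fin 1 → ℝ => p 0) := by
    simpa using isSemialgebraicFunOn_aeval hσ (MvPolynomial.X 0 : MvPolynomial (Fin 1) ℚ)
  have hDsa : IsSemialgebraicFunOn ℚ σ (fun p => ∏ k ∈ range (g + 1), (p 0 - e (2 * k + 1))) :=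
    IsSemialgebraicFunOn.fun_finsetProd _ hσ fun k hk =>
      hx0.fun_sub (isSemialgebraicFunOn_const_of_isAlgebraic hσ (halg k (mem_range.mp hk)))
  exact (ArcExact.isSemialgebraicFunOn_aeval_apply hσ q 0).div (hDsa.fun_pow 2)
    fun p hp => pow_ne_zero 2 (hD p hp)

/-- A change-of-variables instance between two one-dimensional representations is a truncated
relation in dimension `1`. [cite: KontsevichZagier2001, §1.2 rule (2)] -/
theorem mem_relationsLE_one_of_mem_changeOfVariablesRel {r s : IntegralRep 1}
    (h : of r - of s ∈ changeOfVariablesRel) : of r - of s ∈ relationsLE 1 :=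
  movesLE_subset_relationsLE 1
    ⟨Or.inl (Or.inr h), sub_mem (of_mem_formalRepLE r le_rfl) (of_mem_formalRepLE s le_rfl)⟩

end Engine

open Engine in
/-- **Stub `stub_engine`** (the contraction ENGINE, all M-polynomials; registered stub of the line
`Lines/birth.lean` of crux stmt-KontsevichZagierPeriods-12475): for every `q ∈ ℚ[X]`, every real
Cauchy relator `Σ_j (−1)^j [O_j, P/√q] ∈ cauchyRel q` lies in `KZ.relationsLE 1`. Proof: the
separating pencil (file docstring) — `g + 1` change-of-variables instances along `ψ = q/D²`, one per
oval, onto the common domain `(0, ∞)`, followed by the Lagrange cancellation of the signed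
integrands (iterated rule (1b)). [cite: KontsevichZagier2001, §1.2 rules (1)-(2)]
[cite: GrossHarris1981, §3] -/
theorem stub_engine : ∀ (q : Polynomial ℚ), cauchyRel q ⊆ (KZ.relationsLE 1 : Set KZ.FormalRep) := by
  rintro q x ⟨g, e, P, r, hdeg, hlc, he, hroot, hP, hdom, hint, rfl⟩
  -- `deg P < g` forces `g = n + 1 ≥ 1`
  obtain ⟨n, rfl⟩ : ∃ n, g = n + 1 := ⟨g - 1, by omega⟩
  -- basic data: `q ≠ 0`, the roots are real algebraic, `λ = −lc > 0`
  have hq0 : q ≠ 0 := by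
    rintro rfl
    simp at hdeg
  have halg : ∀ i, i < 2 * (n + 1) + 2 → IsAlgebraic ℚ (e i) := fun i hi =>
    ⟨q, hq0, (hroot _).mpr ⟨i, hi, rfl⟩⟩
  set lam : ℝ := -(q.leadingCoeff : ℝ) with hlam_def
  have hlam : 0 < lam := by
    rw [hlam_def, neg_pos]
    exact_mod_cast hlc
  -- `N`, `D`, `q = −λ·N·D`
  set N : ℝ → ℝ := fun t => ∏ k ∈ range (n + 2), (t - e (2 * k)) with hN_def
  set D : ℝ → ℝ := fun t => ∏ k ∈ range (n + 2), (t - e (2 * k + 1)) with hD_def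
  have hqND : ∀ t, (Polynomial.aeval t q : ℝ) = -lam * (N t * D t) := fun t => by
    rw [engine_mPoly_factor q (2 * (n + 1) + 2) e hdeg he hroot t,
      show 2 * (n + 1) + 2 = 2 * (n + 2) by ring, engine_prod_range_even_odd _ (n + 2), hlam_def,
      neg_neg]
  -- the same as real polynomials (for derivatives)
  set NR : ℝ[X] := ∏ k ∈ range (n + 2), (Polynomial.X - Polynomial.C (e (2 * k))) with hNR_def
  set DR : ℝ[X] := ∏ k ∈ range (n + 2), (Polynomial.X - Polynomial.C (e (2 * k + 1))) with hDR_def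
  set qR : ℝ[X] := Polynomial.C (-lam) * NR * DR with hqR_def
  have hNR : ∀ t, NR.eval t = N t := fun t => by
    simp only [hNR_def, hN_def, Polynomial.eval_prod, Polynomial.eval_sub, Polynomial.eval_X,
      Polynomial.eval_C]
  have hDR : ∀ t, DR.eval t = D t := fun t => by
    simp only [hDR_def, hD_def, Polynomial.eval_prod, Polynomial.eval_sub, Polynomial.eval_X,
      Polynomial.eval_C]
  have hqR : ∀ t, qR.eval t = (Polynomial.aeval t q : ℝ) := fun t => by
    rw [hqND t, hqR_def, Polynomial.eval_mul, Polynomial.eval_mul, Polynomial.eval_C, hNR, hDR,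
      mul_assoc]
  -- `ψ = q/D²` and its derivative
  set ψ : ℝ → ℝ := fun t => (Polynomial.aeval t q : ℝ) / (D t) ^ 2 with hψ_def
  set ψ' : ℝ → ℝ := fun t =>
    (qR.derivative.eval t * DR.eval t - 2 * qR.eval t * DR.derivative.eval t) / (DR.eval t) ^ 3
    with hψ'_def
  have hψder : ∀ t, D t ≠ 0 → HasDerivAt ψ (ψ' t) t := fun t ht => by
    have h := hasDerivAt_psi qR DR t (by rwa [hDR])
    have hfun : (fun s => qR.eval s / (DR.eval s) ^ 2) = ψ := by
      funext s
      simp only [hψ_def, hqR, hDR]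
    rwa [hfun] at h
  -- the ovals: `D ≠ 0`, `q > 0`, `ψ > 0`
  have hjle : ∀ j : Fin (n + 2), (j : ℕ) ≤ n + 1 := fun j => by have := j.isLt; omega
  have hovalD : ∀ (j : Fin (n + 2)) (t : ℝ), t ∈ Set.Ioo (e (2 * (j : ℕ))) (e (2 * (j : ℕ) + 1)) →
      D t ≠ 0 := fun j t ht => (oval_ND (n + 1) e he j (hjle j) t ht).1
  have hqpos : ∀ (j : Fin (n + 2)) (t : ℝ), t ∈ Set.Ioo (e (2 * (j : ℕ))) (e (2 * (j : ℕ) + 1)) →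
      0 < (Polynomial.aeval t q : ℝ) := fun j t ht => by
    rw [hqND t, neg_mul, ← mul_neg]
    exact mul_pos hlam (oval_ND (n + 1) e he j (hjle j) t ht).2.2
  have hψpos : ∀ (j : Fin (n + 2)) (t : ℝ), t ∈ Set.Ioo (e (2 * (j : ℕ))) (e (2 * (j : ℕ) + 1)) →
      0 < ψ t := fun j t ht =>
    div_pos (hqpos j t ht) (sq_pos_iff.mpr (hovalD j t ht))
  -- the pencil roots `X u _ j ∈ O_j`, `c_u = (λ + u) ∏_m (X − x_m)`
  have hpr := fun (u : ℝ) (hu : 0 < u) => engine_pencil_roots (n + 1) e lam u he hlam hu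
  choose X hXmono hXmem hXfac using hpr
  -- (a) `ψ(x_j(u)) = u`
  have hXroot : ∀ (u : ℝ) (hu : 0 < u) (j : Fin (n + 2)),
      lam * N (X u hu j) + u * D (X u hu j) = 0 := fun u hu j => by
    have h := hXfac u hu (X u hu j)
    rw [Finset.prod_eq_zero (Finset.mem_univ j) (sub_self _), mul_zero] at h
    exact h
  have hψX : ∀ (u : ℝ) (hu : 0 < u) (j : Fin (n + 2)), ψ (X u hu j) = u := fun u hu j =>
    psi_eq_of_pencil_eq_zero lam u (N _) (D _) _ (hovalD j _ (hXmem u hu j)) (hqND _)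
      (hXroot u hu j)
  -- (b) every point of `O_j` is the `j`-th root of its own pencil: `x_j(ψ t) = t`
  have hXψ : ∀ (j : Fin (n + 2)) (t : ℝ)
      (ht : t ∈ Set.Ioo (e (2 * (j : ℕ))) (e (2 * (j : ℕ) + 1))),
      X (ψ t) (hψpos j t ht) j = t := fun j t ht => by
    have h0 : lam * N t + ψ t * D t = 0 :=
      pencil_eq_zero_of_psi lam (N t) (D t) _ (hovalD j t ht) (hqND t)
    have hfac := hXfac (ψ t) (hψpos j t ht) t
    rw [h0] at hfac
    have hprod : ∏ m, (t - X (ψ t) (hψpos j t ht) m) = 0 := by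
      have hne : lam + ψ t ≠ 0 := (add_pos hlam (hψpos j t ht)).ne'
      rcases mul_eq_zero.mp hfac.symm with h | h
      · exact absurd h hne
      · exact h
    exact (eq_root_of_prod_eq_zero (n + 1) e he _ (hXmem _ _) j t ht hprod).symm
  -- (c) `ψ'` on the fibre: `ψ'(x_j) = −(λ+u)∏_{m≠j}(x_j − x_m)/D(x_j)`, in particular `ψ' ≠ 0`
  have hψ'X : ∀ (u : ℝ) (hu : 0 < u) (j : Fin (n + 2)), ψ' (X u hu j) =
      -((lam + u) * ∏ m ∈ univ.erase j, (X u hu j - X u hu m)) / D (X u hu j) := fun u hu j => by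
    have hpoly : Polynomial.C lam * NR + Polynomial.C u * DR =
        Polynomial.C (lam + u) * ∏ m, (Polynomial.X - Polynomial.C (X u hu m)) := by
      refine Polynomial.funext fun t => ?_
      simp only [Polynomial.eval_add, Polynomial.eval_mul, Polynomial.eval_C, hNR, hDR,
        Polynomial.eval_prod, Polynomial.eval_sub, Polynomial.eval_X]
      exact hXfac u hu t
    have h := psi'_eq_of_pencil NR DR lam u (X u hu j) (by rw [hDR]; exact hovalD j _ (hXmem u hu j))
      (by rw [hNR, hDR]; exact hXroot u hu j)
    rw [hpoly, derivative_C_mul_nodal_eval] at h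
    simp only [hψ'_def]
    rw [hDR] at h ⊢
    exact h
  have hψ'ne : ∀ (j : Fin (n + 2)) (t : ℝ), t ∈ Set.Ioo (e (2 * (j : ℕ))) (e (2 * (j : ℕ) + 1)) →
      ψ' t ≠ 0 := fun j t ht => by
    have hu := hψpos j t ht
    rw [← hXψ j t ht, hψ'X (ψ t) hu j]
    refine div_ne_zero (neg_ne_zero.mpr (mul_ne_zero (add_pos hlam hu).ne' ?_))
      (hovalD j _ (hXmem _ hu j))
    have hsgn := engine_root_gap_sign (n + 1) (X (ψ t) hu) (hXmono _ hu) j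
    intro h0
    rw [h0, mul_zero] at hsgn
    exact lt_irrefl _ hsgn
  -- (d) one rule-(2) push-forward per oval, onto the common domain `T = (0, ∞)`
  set T : Set (Fin 1 → ℝ) := {p | 0 < p 0} with hT_def
  set PR : ℝ[X] := P.map (algebraMap ℚ ℝ) with hPR_def
  have hPR : ∀ t, PR.eval t = (Polynomial.aeval t P : ℝ) := fun t => by
    rw [hPR_def, Polynomial.eval_map_algebraMap]
  have hpush : ∀ j : Fin (n + 2), ∃ s : IntegralRep 1, s.domain = T ∧
      (∀ (u : ℝ) (hu : 0 < u), s.integrand (fun _ => u) =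
        (-1 : ℝ) ^ (n + 1 - (j : ℕ)) * PR.eval (X u hu j) /
          ((Real.sqrt u * (lam + u)) * ∏ m ∈ univ.erase j, (X u hu j - X u hu m))) ∧
      of (r j) - of s ∈ relationsLE 1 := by
    intro j
    have hmem : ∀ p : Fin 1 → ℝ, p ∈ (r j).domain ↔
        p 0 ∈ Set.Ioo (e (2 * (j : ℕ))) (e (2 * (j : ℕ) + 1)) := fun p => by
      rw [hdom j]; rfl
    have hσ : IsSemialgebraic ℚ (r j).domain := (r j).isSemialgebraic_domain
    -- `ψ`, `ψ'` semialgebraic on the oval, `ψ'` the derivative, nowhere zero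
    have hφ : IsSemialgebraicFunOn ℚ (r j).domain (fun p => ψ (p 0)) :=
      psi_semialgebraic q (n + 1) e (fun k hk => halg (2 * k + 1) (by omega)) hσ
        fun p hp => hovalD j _ ((hmem p).1 hp)
    have hder : ∀ p ∈ (r j).domain, HasDerivAt ψ (ψ' (p 0)) (p 0) := fun p hp =>
      hψder _ (hovalD j _ ((hmem p).1 hp))
    have hφ' : IsSemialgebraicFunOn ℚ (r j).domain (fun p => ψ' (p 0)) := by
      have hlt : e (2 * (j : ℕ)) < e (2 * (j : ℕ) + 1) := he (by omega)
      have h := IsSemialgebraicFunOn.hasDerivAt_isSemialgebraic_holds (e (2 * (j : ℕ)))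
        (e (2 * (j : ℕ) + 1)) ψ ψ' hlt (by rw [hdom j] at hφ; exact hφ)
        (fun t ht => hψder t (hovalD j t ht))
      rw [hdom j]
      exact h
    have hne : ∀ p ∈ (r j).domain, ψ' (p 0) ≠ 0 := fun p hp => hψ'ne j _ ((hmem p).1 hp)
    -- injectivity of `Φ = (ψ ∘ coord)` on the oval and its semialgebraic inverse
    set Φ : (Fin 1 → ℝ) → (Fin 1 → ℝ) := fun p _ => ψ (p 0) with hΦ_def
    have hΦsa : IsSemialgebraicMapOn ℚ (r j).domain Φ := IsSemialgebraicMapOn.of_forall hσ fun _ => hφ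
    have hinj : InjOn Φ (r j).domain := by
      intro p hp p' hp' h
      have h0 : ψ (p 0) = ψ (p' 0) := congrFun h 0
      have hp0 := hXψ j _ ((hmem p).1 hp)
      have hp'0 := hXψ j _ ((hmem p').1 hp')
      have key : p 0 = p' 0 := by
        rw [← hp0, ← hp'0]
        simp only [h0]
      funext i
      rw [Fin.fin_one_eq_zero i]
      exact key
    have hG := stub_semialgebraicInvFunOn hΦsa hinj
    have hGφ : ∀ p ∈ (r j).domain, Function.invFunOn Φ (r j).domain (fun _ => ψ (p 0)) = p :=
      fun p hp => hinj.leftInvOn_invFunOn hp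
    obtain ⟨s, hsdom, hsint, hsrel⟩ :=
      stub_pushforwardDimOne (r j) ψ ψ' (Function.invFunOn Φ (r j).domain) hφ hφ' hder hne hG hGφ
    refine ⟨s, ?_, fun u hu => ?_, mem_relationsLE_one_of_mem_changeOfVariablesRel hsrel⟩
    · -- the image of the oval under `ψ` is `(0, ∞)`
      rw [hsdom]
      ext w
      constructor
      · rintro ⟨p, hp, rfl⟩
        exact hψpos j _ ((hmem p).1 hp)
      · intro hw
        refine ⟨fun _ => X (w 0) hw j, (hmem _).2 (hXmem _ hw j), ?_⟩
        funext i
        rw [Fin.fin_one_eq_zero i]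
        exact hψX _ hw j
    · -- the value of the pushed-forward integrand at `u`
      have hp : (fun _ => X u hu j : Fin 1 → ℝ) ∈ (r j).domain := (hmem _).2 (hXmem u hu j)
      have h := hsint _ hp
      simp only [hψX u hu j] at h
      rw [h, hint j hp]
      dsimp only
      have hDj : D (X u hu j) ≠ 0 := hovalD j _ (hXmem u hu j)
      have hqj : (Polynomial.aeval (X u hu j) q : ℝ) = u * D (X u hu j) ^ 2 := by
        have := hψX u hu j
        simp only [hψ_def] at this
        rw [div_eq_iff (pow_ne_zero 2 hDj)] at this
        exact this
      rw [← hPR, pushforward_value (n + 1) j (PR.eval (X u hu j)) _ u (lam + u) (D (X u hu j))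
        (∏ m ∈ univ.erase j, (X u hu j - X u hu m)) (ψ' (X u hu j)) hu (add_pos hlam hu) hDj
        (engine_root_gap_sign (n + 1) (X u hu) (hXmono u hu) j)
        (sqrt_q_eq u (D (X u hu j)) _ hu.le hqj) (hψ'X u hu j), mul_assoc]
  choose s hsT hsval hsrel using hpush
  -- (e) the signed sum of the pushed-forward representations is a truncated relation
  have hsum : ∑ j : Fin (n + 2), ((-1 : ℤ) ^ (j : ℕ)) • of (s j) ∈ relationsLE 1 := by
    refine engine_signed_sum_mem_relationsLE le_rfl T s (fun j => (-1 : ℤ) ^ (j : ℕ)) hsT ?_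
    intro p hp
    have hu : 0 < p 0 := hp
    have hpeq : p = fun _ => p 0 := by
      funext i
      rw [Fin.fin_one_eq_zero i]
    have hPdeg : PR.natDegree ≤ n := by
      rw [hPR_def, Polynomial.natDegree_map]
      omega
    have key := signed_sum_pushforward_eq_zero (X (p 0) hu) (hXmono _ hu).injective PR hPdeg
      (Real.sqrt (p 0) * (lam + p 0))
    rw [hpeq]
    simp only [Int.cast_pow, Int.cast_neg, Int.cast_one, hsval _ _ hu]
    exact key
  -- (f) reassemble: `Σ (−1)^j [r j] = Σ (−1)^j ([r j] − [s j]) + Σ (−1)^j [s j]`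
  have hsplit : ∑ j : Fin (n + 2), ((-1 : ℤ) ^ (j : ℕ)) • of (r j) =
      ∑ j : Fin (n + 2), ((-1 : ℤ) ^ (j : ℕ)) • (of (r j) - of (s j)) +
        ∑ j : Fin (n + 2), ((-1 : ℤ) ^ (j : ℕ)) • of (s j) := by
    rw [← Finset.sum_add_distrib]
    refine Finset.sum_congr rfl fun j _ => ?_
    rw [smul_sub, sub_add_cancel]
  rw [hsplit]
  exact (relationsLE 1).add_mem
    ((relationsLE 1).sum_mem fun j _ => (relationsLE 1).zsmul_mem (hsrel j) _) hsum

end Summit.KontsevichZagierPeriods.AbelContraction.RealHyperellipticSector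

end
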